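import Summits.BirchSwinnertonDyer.BirchSwinnertonDyer.Theorems.KimAtThreeDeepUpperOfPortsOptimal
import Summits.BirchSwinnertonDyer.BirchSwinnertonDyer.Theorems.KimAtThreeShallowEqDeepGoodCoreVertexDevissage
import Summits.BirchSwinnertonDyer.Rank1Residual.GaloisImage.CanonicalKolyvaginDatumAdmissibleDeep
import HarnessLib

/-!
# Route `KimAtThreeKolyvagin` (rung W2), crux `DeepUpperAtThree` (item 19076): the dévissage port
# `hDev` of the END-OF-PORTS theorem DISCHARGED (seat w2-c4's `kummer_atLevel_eq_bot_of_residual_rat_deep`)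
# — ONE new inline port (`hStub`) remains

Cell `bsd-addord`, seat `bsd-addord-w2-c3` (D-0074 row B6), item `stmt-BirchSwinnertonDyer-19076`.
Sequel of `KimAtThreeDeepUpperOfPorts` (p431940) / `…OfPortsOptimal` (p432628).  Theorems only (no
definition, no named fact, no `sorry`); crux 19076 stays OPEN; nothing asserted about any curve.

WHAT.  The END-OF-PORTS theorem `deepUpper_conclusion_of_ports` carries two NEW ports inline: the
STUB at `∅` (`hStub`, Mazur–Rubin Thm. 4.4.1/4.3.4 at `p = 3`, general `m`) and the Kummer dévissage
`hDev` (`H¹_{𝓚(d)}(ℚ, E[3]) = 0 ⟹ H¹_{𝓚(d)}(ℚ, E[3^{k+1}]) = 0` at a level of a With-guarded datum).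
Seat w2-c4 (g3) landed the dévissage as a THEOREM
(`KimAtThreeShallowEqDeepGoodCoreVertex.kummer_atLevel_eq_bot_of_residual_rat_deep`, p430948: Kummer
conditions cartesian along `E[3] ↪ E[3^{k+1}·3]` at every place, transverse pull at the deep-class
primes, `incl_*` onto the `3`-torsion of `H¹`).  This file:
* `kummerDevissage_of_towerSurj` — the binder `hDev` VERBATIM, as a theorem under the `3`-adic tower:
  depth `k ≥ 1` is w2-c4's theorem with its inputs read off the With-guard (`τ` with its shape at the
  three levels `k`, `k − 1` — `FrobShape.nonempty_cokerSubOne_equiv_zmod_pow_mul_of_le` — and `E[3]`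
  — n1011-p13's `nonempty_cokerSubOne_equiv_zmod_pow_of_le` —, admissibility of THE canonical
  comparison maps on a sub-class, `FSComp.isAdmissible_of_hasCanonicalComparison_of_subset_primePow`);
  depth `k = 0` is the respelling `E[3^0·3] = E[3]` (`𝓕(d)` depends on the datum only through its
  transverse structure);
* **`deepUpper_conclusion_of_ports_of_towerSurj`**, `deepUpper_datum_of_ports_of_towerSurj`,
  `deepUpper_optimal_of_ports_of_towerSurj` — the three END-OF-PORTS theorems with `hDev` discharged:
  crux 19076's conclusion at a Kato-stratum row / in the crux's currency / at an optimal datum, GRANTED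
  `hS24`/`hS24₂` (PUB), GZK (PUB), the Poitou–Tate families, ONE port
  `KatoKuriharaPortThreeAtWith₂ W 0 v₃ η D` (FLAG `K22-Thm3.13-PORT@3`) and ONE new inline port `hStub`.
[cite: Kim2025RefinedTNC, Thm 1.1, §5] [cite: Kim2022StructureSelmer, Thm. 1.9 (6) and Thm. 3.13]
[cite: MazurRubin2004, Thm. 4.4.1, Lemma 3.5.3, Cor. 4.1.9] [cite: Sakamoto2024, Def. 3.5 and Thm. 4.4 (p. 926)]
-/

set_option autoImplicit false
-- the Theorems namespace of a single-conjunct summit repeats the summit name by design (D-0017)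
set_option linter.dupNamespace false

noncomputable section

open scoped Classical NumberField ContRepresentation
open Function Field NumberField IsDedekindDomain IsDedekindDomain.HeightOneSpectrum WeierstrassCurve
  CongruenceSubgroup
  Literature.NumberTheory.EllipticCurves Literature.NumberTheory.EllipticCurves.ModularForms
  Literature.NumberTheory.EllipticCurves.Rank1Residual
  Literature.NumberTheory.GaloisRepresentations
  Literature.NumberTheory.GaloisRepresentations.DiscreteGaloisModule Literature.NumberTheory.GaloisCohomology
  Rat.HeightOneSpectrum
  Summit.BirchSwinnertonDyer.Rank1Residual.GaloisImage
  Summit.BirchSwinnertonDyer.Rank1Residual.X4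
  Summit.BirchSwinnertonDyer.BirchSwinnertonDyer.Theorems
  Summit.BirchSwinnertonDyer.BirchSwinnertonDyer.Theorems.KimAtThreeDeepUpperOfPorts
  Summit.BirchSwinnertonDyer.BirchSwinnertonDyer.Theorems.KimAtThreeDeepUpperOfPortsOptimal
  Summit.BirchSwinnertonDyer.BirchSwinnertonDyer.Theorems.KimAtThreeShallowEqDeepGoodCoreVertex

namespace Summit.BirchSwinnertonDyer.BirchSwinnertonDyer.Theorems.KimAtThreeDeepUpperOfPortsDevissage

/-- **The dévissage port `hDev` is a THEOREM under the `3`-adic tower.**  For every depth `k`, every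
With-guarded datum `Dk` on `E[3^{k+1}]` (cyclotomic transverse conditions, THE canonical comparison
maps for `η`, primes in a Sakamoto `τ`-class of depth `k`), every datum `D₁` on `E[3]` with the same
primes and cyclotomic transverse conditions, and every level `d` of `Dk`:
`H¹_{𝓚(d)}(ℚ, E[3]) = 0 ⟹ H¹_{𝓚(d)}(ℚ, E[3^{k+1}]) = 0` — depth `≥ 1` by seat w2-c4's
`kummer_atLevel_eq_bot_of_residual_rat_deep`, depth `0` by the respelling `E[3^0·3] = E[3]`.
[cite: MazurRubin2004, Lemma 3.5.3 and Prop. 4.1.3] [cite: Sakamoto2024, Def. 3.5 (p. 923)] -/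
theorem kummerDevissage_of_towerSurj (W : WeierstrassCurve ℚ) [W.IsElliptic]
    (htower : ∀ m : ℕ, W.HasSurjectiveModNGaloisRep (3 ^ m : ℕ))
    (η : (q : HeightOneSpectrum (𝓞 ℚ)) → (ZMod (Ideal.absNorm q.asIdeal))ˣ) :
    ∀ (k : ℕ) (Dk : KolyvaginDatum (W.torsionGaloisModule (((3 : ℕ) : ℤ) ^ k * ((3 : ℕ) : ℤ))))
      (D₁ : KolyvaginDatum (W.torsionGaloisModule ((3 : ℕ) : ℤ)))
      (d : Finset (HeightOneSpectrum (𝓞 ℚ))), Dk.IsCanonicalTauDatumThreeAtWith W k k η →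
        D₁.primes = Dk.primes → D₁.transverse = cyclotomicTransverse _ → Dk.IsLevel d →
        (D₁.atLevel (W.kummerSelmerStructure ((3 : ℕ) : ℤ)) d).selmerGroup = ⊥ →
        (Dk.atLevel (W.kummerSelmerStructure (((3 : ℕ) : ℤ) ^ k * ((3 : ℕ) : ℤ))) d).selmerGroup = ⊥ := by
  haveI : Fact (Nat.Prime 3) := ⟨Nat.prime_three⟩
  intro k Dk D₁ d hguard _ hT₁ hd hbot
  obtain ⟨hT₂, hcan, S, τ, -, hτμ, hτq, hPsub⟩ := hguard
  cases k with
  | zero =>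
    -- the respelling `E[3^0·3] = E[3]`: `𝓚(d)` depends on the datum only through `𝒯`
    have key : ∀ (n : ℤ), n = ((3 : ℕ) : ℤ) →
        ∀ (D₂ : KolyvaginDatum (W.torsionGaloisModule n)),
          D₂.transverse = cyclotomicTransverse _ →
          (D₂.atLevel (W.kummerSelmerStructure n) d).selmerGroup = ⊥ := by
      intro n hn
      subst hn
      intro D₂ hT₂'
      have h : D₂.atLevel (W.kummerSelmerStructure ((3 : ℕ) : ℤ)) d =
          D₁.atLevel (W.kummerSelmerStructure ((3 : ℕ) : ℤ)) d := by
        change (W.kummerSelmerStructure ((3 : ℕ) : ℤ)).transverseAt D₂.transverse d =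
          (W.kummerSelmerStructure ((3 : ℕ) : ℤ)).transverseAt D₁.transverse d
        rw [hT₂', hT₁]
      rw [h]
      exact hbot
    exact key _ (by norm_num) Dk hT₂
  | succ k =>
    haveI : NeZero (3 ^ (k + 1 + 1)) := ⟨pow_ne_zero _ three_ne_zero⟩
    haveI : Finite (geomTorsion W ((3 : ℕ) : ℤ)) :=
      finite_torsionPoints_holds W (AlgebraicClosure ℚ) (by norm_num)
    have h3 : W.HasSurjectiveModNGaloisRep ((3 : ℕ) : ℤ) := by simpa using htower 1
    -- the `τ` of the guard at the three levels
    have hτ₃ : Nonempty (cokerSubOne (W.torsionGaloisModule (((3 : ℕ) : ℤ) ^ k * ((3 : ℕ) : ℤ))) τ ≃+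
        ZMod (3 ^ (k + 1))) :=
      FrobShape.nonempty_cokerSubOne_equiv_zmod_pow_mul_of_le W Nat.prime_three (Nat.le_succ k) τ hτq
    have hτ₁ : Nonempty (cokerSubOne (W.torsionGaloisModule ((3 : ℕ) : ℤ)) τ ≃+ ZMod 3) := by
      have h := FrobShape.nonempty_cokerSubOne_equiv_zmod_pow_mul_of_le W Nat.prime_three
        (Nat.zero_le (k + 1)) τ hτq
      have key : ∀ (n : ℤ) (m : ℕ), n = ((3 : ℕ) : ℤ) ^ 0 * ((3 : ℕ) : ℤ) → m = 3 ^ (0 + 1) →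
          Nonempty (cokerSubOne (W.torsionGaloisModule n) τ ≃+ ZMod m) := by
        intro n m hn hm
        subst hn hm
        exact h
      exact key _ _ (by norm_num) (by norm_num)
    -- admissibility of THE canonical comparison maps on the sub-class
    have hadm : Dk.IsAdmissible :=
      FSComp.isAdmissible_of_hasCanonicalComparison_of_subset_primePow
        (W.torsionGaloisModule (((3 : ℕ) : ℤ) ^ (k + 1) * ((3 : ℕ) : ℤ))) 3 (k + 1 + 1) S hτq hτμ hPsub
        hcan
    exact kummer_atLevel_eq_bot_of_residual_rat_deep W k h3 hτμ hτq hτ₃ hτ₁ D₁ Dk hPsub hT₁ hT₂ hadm hd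
      hbot

/-- **Crux 19076 at a Kato-stratum row from the ports, the dévissage DISCHARGED.**  Row: `W/ℚ`
globally minimal, ADDITIVE at `3` with `3 ∤ c₃`, the `3`-adic tower onto, `E(ℚ₃)[3] = 0`, `L(E,1) ≠ 0`,
a datum `D` with `3 ∤ c_D`, the `3`-adic period transfer, `3`-integral plus symbols.  Inputs:
`hS24`/`hS24₂` (PUB), GZK (PUB), Poitou–Tate families, ONE port `KatoKuriharaPortThreeAtWith₂ W 0 v₃ η D`
(FLAG `K22-Thm3.13-PORT@3`) and ONE new inline port `hStub` (the STUB at `∅`, general `m`,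
Mazur–Rubin Thm. 4.4.1).  Conclusion: `∃ d, ∂^{(∞)}_deep(δ̃) = d ∧ ord₃ #Ш(E/ℚ)(3) + d ≤ ∂⁽⁰⁾(δ̃)` for
`f = D.f`. [cite: Kim2025RefinedTNC, Thm 1.1, §5] [cite: Kim2022StructureSelmer, Thm. 1.9 (6) and Thm. 3.13]
[cite: MazurRubin2004, Thm. 4.4.1 and Cor. 4.1.9] [cite: Sakamoto2024, Thm. 4.4 (p. 926)] -/
theorem deepUpper_conclusion_of_ports_of_towerSurj
    (hS24 : Sakamoto2024.kolyvaginSystems_freeRankOne_zmod_three_pow)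
    (hS24₂ : Sakamoto2024.kolyvaginSystems_idealOfBasis_eq_fittingIdeal_zmod_three_pow)
    (hGZK : rank_eq_analyticRank_of_analyticRank_le_one)
    (W : WeierstrassCurve ℚ) [W.IsElliptic] [W.IsGloballyMinimal]
    (hadd : haveI : Fact (Nat.Prime 3) := ⟨Nat.prime_three⟩; Addv W 3)
    (hc3 : ¬ 3 ∣ (W.baseChange ℚ_[3]).localTamagawaNumber ℤ_[3])
    (htower : ∀ m : ℕ, W.HasSurjectiveModNGaloisRep (3 ^ m : ℕ))
    (ht0 : Nat.card {Q : (W.baseChange ℚ_[3]).toAffine.Point // (3 : ℕ) • Q = 0} = 1)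
    (hL : W.entireLFunction 1 ≠ 0)
    {N : ℕ} [NeZero N] (D : ModularParametrizationData W N) (hcD : ¬ (3 : ℤ) ∣ D.maninConstant)
    (hper : ∃ u : ℚ, ‖(u : ℚ_[3])‖ = 1 ∧ W.realPeriodRat = u * plusPeriod D.f)
    (hint : ∀ r : ℚ, ratPlusSymbol D.f r ≠ 0 → 0 ≤ padicValRat 3 (ratPlusSymbol D.f r))
    (inv : LocalInvariants ℚ 3) (hperf : inv.IsPerfect) (hsum : inv.SumLocalTermEqZero)
    (hcompl : inv.SelmerComplement)
    (inv' : ∀ k' : ℕ, LocalInvariants ℚ (3 ^ (k' + 1))) (hperf' : ∀ k', (inv' k').IsPerfect)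
    (hsum' : ∀ k', (inv' k').SumLocalTermEqZero) (hcompl' : ∀ k', (inv' k').SelmerComplement)
    (hinj' : ∀ k', ∀ v : HeightOneSpectrum (𝓞 ℚ), Injective (inv' k' (Sum.inr v)))
    (v₃ : HeightOneSpectrum (𝓞 ℚ)) (hv₃ : ((3 : ℕ) : 𝓞 ℚ) ∈ v₃.asIdeal)
    (η : (q : HeightOneSpectrum (𝓞 ℚ)) → (ZMod (Ideal.absNorm q.asIdeal))ˣ)
    (hη : ∀ q : HeightOneSpectrum (𝓞 ℚ), Subgroup.zpowers (η q) = ⊤)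
    (hPort : KatoKuriharaPortThreeAtWith₂ W 0 v₃ η D)
    (hStub : ∀ (k : ℕ)
      (Dk : KolyvaginDatum (W.torsionGaloisModule (((3 : ℕ) : ℤ) ^ k * ((3 : ℕ) : ℤ))))
      (g : Finset (HeightOneSpectrum (𝓞 ℚ)) →
        galoisCohomology (W.torsionGaloisModule (((3 : ℕ) : ℤ) ^ k * ((3 : ℕ) : ℤ))) 1)
      (n₀ : ℕ), Dk.IsCanonicalTauDatumThreeAtWith W k k η →
        g ∈ Dk.kolyvaginSystems (propagatedSelmerStructure W 3 k) →
        (∀ κ ∈ Dk.kolyvaginSystems (propagatedSelmerStructure W 3 k), ∃ a : ℕ, κ = a • g) →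
        Nat.card (propagatedSelmerStructure W 3 k).selmerGroup = 3 ^ (k + 1) * 3 ^ n₀ →
        ∃ e ∈ (propagatedSelmerStructure W 3 k).selmerGroup,
          ∃ m ∈ (W.kummerSelmerStructure (((3 : ℕ) : ℤ) ^ k * ((3 : ℕ) : ℤ))).selmerGroup,
            g ∅ = 3 ^ n₀ • e + m) :
    ∃ dd : ℕ, kuriharaPartialDeepInfty W 3 D.f = dd ∧
      ((padicValNat 3 (Nat.card (AddCommGroup.primaryComponent W.sha 3)) + dd : ℕ) : ℕ∞) ≤
        kuriharaPartial W 3 D.f 0 :=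
  deepUpper_conclusion_of_ports hS24 hS24₂ hGZK W hadd hc3 htower ht0 hL D hcD hper hint inv hperf hsum hcompl
    inv' hperf' hsum' hcompl' hinj' v₃ hv₃ η hη hPort hStub (kummerDevissage_of_towerSurj W htower η)

/-- **The same in the crux's currency** (`ord(δ̃) = 0` for `D.f` instead of `L(E,1) ≠ 0`), dévissage
discharged. [cite: Kim2025RefinedTNC, Thm 1.1, §5] [cite: MazurRubin2004, Thm. 4.4.1] -/
theorem deepUpper_datum_of_ports_of_towerSurj
    (hS24 : Sakamoto2024.kolyvaginSystems_freeRankOne_zmod_three_pow)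
    (hS24₂ : Sakamoto2024.kolyvaginSystems_idealOfBasis_eq_fittingIdeal_zmod_three_pow)
    (hGZK : rank_eq_analyticRank_of_analyticRank_le_one)
    (W : WeierstrassCurve ℚ) [W.IsElliptic] [W.IsGloballyMinimal]
    (hadd : haveI : Fact (Nat.Prime 3) := ⟨Nat.prime_three⟩; Addv W 3)
    (hc3 : ¬ 3 ∣ (W.baseChange ℚ_[3]).localTamagawaNumber ℤ_[3])
    (htower : ∀ m : ℕ, W.HasSurjectiveModNGaloisRep (3 ^ m : ℕ))
    (ht0 : Nat.card {Q : (W.baseChange ℚ_[3]).toAffine.Point // (3 : ℕ) • Q = 0} = 1)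
    {N : ℕ} [NeZero N] (D : ModularParametrizationData W N) (hcD : ¬ (3 : ℤ) ∣ D.maninConstant)
    (hper : ∃ u : ℚ, ‖(u : ℚ_[3])‖ = 1 ∧ W.realPeriodRat = u * plusPeriod D.f)
    (hint : ∀ r : ℚ, ratPlusSymbol D.f r ≠ 0 → 0 ≤ padicValRat 3 (ratPlusSymbol D.f r))
    (hord : kuriharaVanishingOrder W 3 D.f = 0)
    (inv : LocalInvariants ℚ 3) (hperf : inv.IsPerfect) (hsum : inv.SumLocalTermEqZero)
    (hcompl : inv.SelmerComplement)
    (inv' : ∀ k' : ℕ, LocalInvariants ℚ (3 ^ (k' + 1))) (hperf' : ∀ k', (inv' k').IsPerfect)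
    (hsum' : ∀ k', (inv' k').SumLocalTermEqZero) (hcompl' : ∀ k', (inv' k').SelmerComplement)
    (hinj' : ∀ k', ∀ v : HeightOneSpectrum (𝓞 ℚ), Injective (inv' k' (Sum.inr v)))
    (v₃ : HeightOneSpectrum (𝓞 ℚ)) (hv₃ : ((3 : ℕ) : 𝓞 ℚ) ∈ v₃.asIdeal)
    (η : (q : HeightOneSpectrum (𝓞 ℚ)) → (ZMod (Ideal.absNorm q.asIdeal))ˣ)
    (hη : ∀ q : HeightOneSpectrum (𝓞 ℚ), Subgroup.zpowers (η q) = ⊤)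
    (hPort : KatoKuriharaPortThreeAtWith₂ W 0 v₃ η D)
    (hStub : ∀ (k : ℕ)
      (Dk : KolyvaginDatum (W.torsionGaloisModule (((3 : ℕ) : ℤ) ^ k * ((3 : ℕ) : ℤ))))
      (g : Finset (HeightOneSpectrum (𝓞 ℚ)) →
        galoisCohomology (W.torsionGaloisModule (((3 : ℕ) : ℤ) ^ k * ((3 : ℕ) : ℤ))) 1)
      (n₀ : ℕ), Dk.IsCanonicalTauDatumThreeAtWith W k k η →
        g ∈ Dk.kolyvaginSystems (propagatedSelmerStructure W 3 k) →
        (∀ κ ∈ Dk.kolyvaginSystems (propagatedSelmerStructure W 3 k), ∃ a : ℕ, κ = a • g) →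
        Nat.card (propagatedSelmerStructure W 3 k).selmerGroup = 3 ^ (k + 1) * 3 ^ n₀ →
        ∃ e ∈ (propagatedSelmerStructure W 3 k).selmerGroup,
          ∃ m ∈ (W.kummerSelmerStructure (((3 : ℕ) : ℤ) ^ k * ((3 : ℕ) : ℤ))).selmerGroup,
            g ∅ = 3 ^ n₀ • e + m) :
    ∃ dd : ℕ, kuriharaPartialDeepInfty W 3 D.f = dd ∧
      ((padicValNat 3 (Nat.card (AddCommGroup.primaryComponent W.sha 3)) + dd : ℕ) : ℕ∞) ≤
        kuriharaPartial W 3 D.f 0 :=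
  deepUpper_datum_of_ports hS24 hS24₂ hGZK W hadd hc3 htower ht0 D hcD hper hint hord inv hperf hsum hcompl
    inv' hperf' hsum' hcompl' hinj' v₃ hv₃ η hη hPort hStub (kummerDevissage_of_towerSurj W htower η)

/-- **The same at an OPTIMAL datum** (period transfer by `X4.periodTransfer_of_optimal`), dévissage
discharged — the per-row premise of kim3's `deepUpperAtThree_of_forall_optimalDatum` on the stratum
{additive `3`, `3 ∤ c₃`, tower, `t = 0`, `3 ∤ c_D`}, GRANTED `hS24`/`hS24₂`, GZK, the Poitou–Tate families,
PORT″ and the STUB. [cite: Kim2025RefinedTNC, Thm 1.1] [cite: CremonaAlgorithms1997, §2.8 (p. 26)]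
[cite: MazurRubin2004, Thm. 4.4.1] -/
theorem deepUpper_optimal_of_ports_of_towerSurj
    (hS24 : Sakamoto2024.kolyvaginSystems_freeRankOne_zmod_three_pow)
    (hS24₂ : Sakamoto2024.kolyvaginSystems_idealOfBasis_eq_fittingIdeal_zmod_three_pow)
    (hGZK : rank_eq_analyticRank_of_analyticRank_le_one)
    (W : WeierstrassCurve ℚ) [W.IsElliptic] [W.IsGloballyMinimal]
    (hadd : haveI : Fact (Nat.Prime 3) := ⟨Nat.prime_three⟩; Addv W 3)
    (hc3 : ¬ 3 ∣ (W.baseChange ℚ_[3]).localTamagawaNumber ℤ_[3])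
    (htower : ∀ m : ℕ, W.HasSurjectiveModNGaloisRep (3 ^ m : ℕ))
    (ht0 : Nat.card {Q : (W.baseChange ℚ_[3]).toAffine.Point // (3 : ℕ) • Q = 0} = 1)
    {N : ℕ} [NeZero N] (D : ModularParametrizationData W N)
    (hopt : ∀ z ∈ D.L.lattice, ∃ w ∈ periodLattice D.f, z = D.c * w)
    (hcD : ¬ (3 : ℤ) ∣ D.maninConstant)
    (hint : ∀ r : ℚ, ratPlusSymbol D.f r ≠ 0 → 0 ≤ padicValRat 3 (ratPlusSymbol D.f r))
    (hord : kuriharaVanishingOrder W 3 D.f = 0)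
    (inv : LocalInvariants ℚ 3) (hperf : inv.IsPerfect) (hsum : inv.SumLocalTermEqZero)
    (hcompl : inv.SelmerComplement)
    (inv' : ∀ k' : ℕ, LocalInvariants ℚ (3 ^ (k' + 1))) (hperf' : ∀ k', (inv' k').IsPerfect)
    (hsum' : ∀ k', (inv' k').SumLocalTermEqZero) (hcompl' : ∀ k', (inv' k').SelmerComplement)
    (hinj' : ∀ k', ∀ v : HeightOneSpectrum (𝓞 ℚ), Injective (inv' k' (Sum.inr v)))
    (v₃ : HeightOneSpectrum (𝓞 ℚ)) (hv₃ : ((3 : ℕ) : 𝓞 ℚ) ∈ v₃.asIdeal)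
    (η : (q : HeightOneSpectrum (𝓞 ℚ)) → (ZMod (Ideal.absNorm q.asIdeal))ˣ)
    (hη : ∀ q : HeightOneSpectrum (𝓞 ℚ), Subgroup.zpowers (η q) = ⊤)
    (hPort : KatoKuriharaPortThreeAtWith₂ W 0 v₃ η D)
    (hStub : ∀ (k : ℕ)
      (Dk : KolyvaginDatum (W.torsionGaloisModule (((3 : ℕ) : ℤ) ^ k * ((3 : ℕ) : ℤ))))
      (g : Finset (HeightOneSpectrum (𝓞 ℚ)) →
        galoisCohomology (W.torsionGaloisModule (((3 : ℕ) : ℤ) ^ k * ((3 : ℕ) : ℤ))) 1)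
      (n₀ : ℕ), Dk.IsCanonicalTauDatumThreeAtWith W k k η →
        g ∈ Dk.kolyvaginSystems (propagatedSelmerStructure W 3 k) →
        (∀ κ ∈ Dk.kolyvaginSystems (propagatedSelmerStructure W 3 k), ∃ a : ℕ, κ = a • g) →
        Nat.card (propagatedSelmerStructure W 3 k).selmerGroup = 3 ^ (k + 1) * 3 ^ n₀ →
        ∃ e ∈ (propagatedSelmerStructure W 3 k).selmerGroup,
          ∃ m ∈ (W.kummerSelmerStructure (((3 : ℕ) : ℤ) ^ k * ((3 : ℕ) : ℤ))).selmerGroup,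
            g ∅ = 3 ^ n₀ • e + m) :
    ∃ dd : ℕ, kuriharaPartialDeepInfty W 3 D.f = dd ∧
      ((padicValNat 3 (Nat.card (AddCommGroup.primaryComponent W.sha 3)) + dd : ℕ) : ℕ∞) ≤
        kuriharaPartial W 3 D.f 0 :=
  deepUpper_optimal_of_ports hS24 hS24₂ hGZK W hadd hc3 htower ht0 D hopt hcD hint hord inv hperf hsum
    hcompl inv' hperf' hsum' hcompl' hinj' v₃ hv₃ η hη hPort hStub (kummerDevissage_of_towerSurj W htower η)

end Summit.BirchSwinnertonDyer.BirchSwinnertonDyer.Theorems.KimAtThreeDeepUpperOfPortsDevissage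

end
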